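import Summits.QuantumFields.QCD.Theorems.QuarksAsStableActionStableActionBridgeSoftClosureCanonical
import Summits.QuantumFields.QCD.Theorems.QuarksAsStableActionStableActionBridgeStubPermExact
import Summits.QuantumFields.QCD.Theorems.QuarksAsStableActionStableActionBridgeStubOffDiagonalTensorDensity
import HarnessLib

/-!
# Soft OS closure V: the package read on REAL TENSORS — `QCDOf N_f` from the r3d lattice package + the rotation module

Support file for crux `QuarksAsStableAction.StableActionBridge` (item stmt-QuantumFields-9737), line `Sketch` (reshape r3d,
lead c16).  With the wave-1 theorems `stub_permExact` (OS E3 exactly at finite `k`) and `stub_offDiagonalTensorDensity`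
(off-diagonal real tensor products are total in `⁰𝒮`) the hypotheses of `qcdOf_of_canonicalPackage` shrink once more:

* `tendsto_offDiagonal_of_tensor` — ε/3: continuous linear functionals `u k` on `𝓢((ℝ⁴)ⁿ)` eventually uniformly bounded on
  `⁰𝒮` by one Schwartz norm and convergent on off-diagonal real tensor products converge on all of `⁰𝒮` (given totality);
* `tendsto_qcdLatticeDist_of_tensor` — for the canonical lattice distributions: the k-uniform E0′ bound (P2) + convergence of
  the honest lattice `n`-point functions `qcdLatticeSchwinger sch k n σ f` on off-diagonal real tensors (P3′ — literally the
  convergence datum of the statement's `IsQCDAlong`) ⟹ convergence on `⁰𝒮` (P3 of r3c);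
* `qcdOf_of_latticePackage` — `QCDOf N_f` from: ONE mass-scaling, chiral-at-zero regularisation such that at every positive
  mass tuple the scheme has (P1) asymptotic scaling / physical branch, (P2) a k-uniform E0′ bound on `⁰𝒮`, (P3′) convergence
  on off-diagonal real tensors, (P6) asymptotic translation invariance, (P8) eventually approximately positive OS forms,
  (P9) k-uniform spatial clustering, (P10) `HasSpeciesCSClustering Δ ∧ HasLatticeMassGap Δ`, (P11) the three non-vanishing
  witnesses — plus the E1 (rotation) module.  Normalisation, tensor agreement, hermiticity and permutation symmetry are
  theorems and no longer hypotheses.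

References: Osterwalder–Schrader 1973 §2 (`⁰𝒮`), Osterwalder–Schrader II (1975) §4; Glimm–Jaffe 1987 §6.1; Reed–Simon I §V.3.
-/

noncomputable section

open Filter Topology ComplexConjugate
open scoped SchwartzMap
open Literature.MathematicalPhysics.AQFT Literature.MathematicalPhysics.QuantumLattice
open Literature.MathematicalPhysics.QuantumFieldTheory

namespace Summit.QuantumFields.QCD.Cruxes.StableActionBridge.Sketch

/-! ### Convergence on `⁰𝒮` from convergence on off-diagonal real tensors -/

/-- **ε/3-reduction.**  Let `u k` be continuous linear functionals on `𝓢((ℝ⁴)ⁿ, ℂ)` that are EVENTUALLY uniformly bounded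
on `⁰𝒮` by a multiple of one Schwartz norm `|·|_M`, whose values converge on every off-diagonal real tensor product, and
assume off-diagonal real tensor products are total in `⁰𝒮`.  Then `u k F` converges for every `F ∈ ⁰𝒮`: the span consists of
off-diagonal functions on which `u k` converges (linearity); for `F ∈ ⁰𝒮` pick `G` in the span with `|F − G|_M` small
(`|·|_M` is continuous on `𝓢`), so `u k F` is Cauchy. [cite: ReedSimonI1980, Thm I.2 (BLT) / §V.3] -/
theorem tendsto_offDiagonal_of_tensor :
    ∀ {n : ℕ} (u : ℕ → 𝓢((Fin n → (EuclideanSpace ℝ (Fin 4))), ℂ) →L[ℂ] ℂ) {C : ℝ} {M : ℕ}, (∀ᶠ k in atTop, ∀ F : 𝓢((Fin n → (EuclideanSpace ℝ (Fin 4))), ℂ), IsOffDiagonal F → ‖u k F‖ ≤ C * schwartzNorm M F) → (∀ F : 𝓢((Fin n → (EuclideanSpace ℝ (Fin 4))), ℂ), IsOffDiagonal F → F ∈ closure ((Submodule.span ℂ {G : 𝓢((Fin n → (EuclideanSpace ℝ (Fin 4))), ℂ) | G ∈ tensorProducts n ∧ IsOffDiagonal G} : Submodule ℂ 𝓢((Fin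 n → (EuclideanSpace ℝ (Fin 4))), ℂ)) : Set 𝓢((Fin n → (EuclideanSpace ℝ (Fin 4))), ℂ))) → (∀ F : 𝓢((Fin n → (EuclideanSpace ℝ (Fin 4))), ℂ), F ∈ tensorProducts n → IsOffDiagonal F → ∃ c : ℂ, Tendsto (fun k => u k F) atTop (𝓝 c)) → ∀ (F : 𝓢((Fin n → (EuclideanSpace ℝ (Fin 4))), ℂ)), IsOffDiagonal F → ∃ c : ℂ, Tendsto (fun k => u k F) atTop (𝓝 c) := by
  intro n u C M hb hdense hconv F hF
  classical
  -- (1) the span consists of off-diagonal functions on which `u k` converges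
  have hspan : ∀ G ∈ (Submodule.span ℂ {G : 𝓢((Fin n → (EuclideanSpace ℝ (Fin 4))), ℂ) | G ∈ tensorProducts n ∧ IsOffDiagonal G} :
      Submodule ℂ 𝓢((Fin n → (EuclideanSpace ℝ (Fin 4))), ℂ)), IsOffDiagonal G ∧ ∃ c : ℂ, Tendsto (fun k => u k G) atTop (𝓝 c) := by
    intro G hG
    refine Submodule.span_induction ?_ ?_ ?_ ?_ hG
    · rintro G ⟨hGt, hGo⟩
      exact ⟨hGo, hconv G hGt hGo⟩
    · exact ⟨isOffDiagonal_zero, 0, by simpa only [map_zero] using tendsto_const_nhds⟩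
    · rintro G G' - - ⟨hGo, c, hc⟩ ⟨hG'o, c', hc'⟩
      exact ⟨hGo.add hG'o, c + c', by simpa only [map_add] using hc.add hc'⟩
    · rintro a G - ⟨hGo, c, hc⟩
      exact ⟨hGo.smul a, a • c, by simpa only [map_smul] using hc.const_smul a⟩
  -- (2) `u k F` is Cauchy
  have hCauchy : CauchySeq fun k => u k F := by
    rw [Metric.cauchySeq_iff]
    intro ε hε
    set C' : ℝ := |C| + 1 with hC'def
    have hC' : 0 < C' := by positivity
    set δ : ℝ := ε / (4 * C') with hδdef
    have hδ : 0 < δ := by positivity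
    have hC'δ : C' * δ = ε / 4 := by
      rw [hδdef]
      field_simp
    -- a `G` in the span with `|F - G|_M < δ`
    have hqc : Continuous fun G : 𝓢((Fin n → (EuclideanSpace ℝ (Fin 4))), ℂ) => schwartzNorm M G :=
      Seminorm.continuous_finsetSup (s := Finset.Iic (M, M)) fun i _ =>
        (schwartz_withSeminorms ℂ (Fin n → (EuclideanSpace ℝ (Fin 4))) ℂ).continuous_seminorm i
    have hcont : Continuous fun G : 𝓢((Fin n → (EuclideanSpace ℝ (Fin 4))), ℂ) => schwartzNorm M (F - G) :=
      hqc.comp (continuous_const.sub continuous_id)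
    have hnhds : {G : 𝓢((Fin n → (EuclideanSpace ℝ (Fin 4))), ℂ) | schwartzNorm M (F - G) < δ} ∈ 𝓝 F := by
      refine (isOpen_lt hcont continuous_const).mem_nhds ?_
      show schwartzNorm M (F - F) < δ
      have h0 : schwartzNorm M (0 : 𝓢((Fin n → (EuclideanSpace ℝ (Fin 4))), ℂ)) = 0 := map_zero _
      rw [sub_self, h0]
      exact hδ
    obtain ⟨G, hGδ, hGV⟩ := mem_closure_iff_nhds.1 (hdense F hF) _ hnhds
    obtain ⟨hGo, c, hc⟩ := hspan G hGV
    have hcG := hc.cauchySeq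
    rw [Metric.cauchySeq_iff] at hcG
    obtain ⟨N₁, hN₁⟩ := hcG (ε / 4) (by positivity)
    obtain ⟨N₂, hN₂⟩ := eventually_atTop.1 hb
    refine ⟨max N₁ N₂, fun j hj k hk => ?_⟩
    have hFG : IsOffDiagonal (F - G) := hF.sub hGo
    have hsn : 0 ≤ schwartzNorm M (F - G) := apply_nonneg _ _
    have hest : ∀ l, N₂ ≤ l → ‖u l (F - G)‖ ≤ ε / 4 := by
      intro l hl
      calc ‖u l (F - G)‖ ≤ C * schwartzNorm M (F - G) := hN₂ l hl _ hFG
        _ ≤ |C| * schwartzNorm M (F - G) := by gcongr; exact le_abs_self C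
        _ ≤ C' * schwartzNorm M (F - G) := by gcongr; simp [hC'def]
        _ ≤ C' * δ := by gcongr; exact le_of_lt hGδ
        _ = ε / 4 := hC'δ
    have hj₂ := hest j (le_of_max_le_right hj)
    have hk₂ := hest k (le_of_max_le_right hk)
    have hjk := hN₁ j (le_of_max_le_left hj) k (le_of_max_le_left hk)
    rw [dist_eq_norm] at hjk ⊢
    have hsplit : u j F - u k F = (u j (F - G) - u k (F - G)) + (u j G - u k G) := by
      simp only [map_sub]
      abel
    calc ‖u j F - u k F‖ = ‖(u j (F - G) - u k (F - G)) + (u j G - u k G)‖ := by rw [hsplit]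
      _ ≤ ‖u j (F - G) - u k (F - G)‖ + ‖u j G - u k G‖ := norm_add_le _ _
      _ ≤ (‖u j (F - G)‖ + ‖u k (F - G)‖) + ‖u j G - u k G‖ := by gcongr; exact norm_sub_le _ _
      _ ≤ (ε / 4 + ε / 4) + ‖u j G - u k G‖ := by gcongr
      _ < (ε / 4 + ε / 4) + ε / 4 := by gcongr
      _ < ε := by linarith
  exact cauchySeq_tendsto_of_complete hCauchy

/-- **P3 of the r3c package from P2 + P3′ (convergence of the honest lattice `n`-point functions on off-diagonal real
tensors) + the density stub.**  Degree `0` is point evaluation (constant in `k`); in degree `n ≥ 1` the canonical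
distribution IS `qcdLatticeSchwinger` on real tensors (`qcdLatticeSchwinger_eq_qcdLatticeDist`), and
`tendsto_offDiagonal_of_tensor` applies with the k-uniform E0′ bound. [cite: OsterwalderSchraderCMP1975, §4] -/
theorem tendsto_qcdLatticeDist_of_tensor {Nf : ℕ} (sch : QCDScheme Nf)
    (hdense : ∀ (n : ℕ) (F : 𝓢((Fin n → (EuclideanSpace ℝ (Fin 4))), ℂ)), IsOffDiagonal F →
      F ∈ closure ((Submodule.span ℂ {G : 𝓢((Fin n → (EuclideanSpace ℝ (Fin 4))), ℂ) | G ∈ tensorProducts n ∧ IsOffDiagonal G} :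
        Submodule ℂ 𝓢((Fin n → (EuclideanSpace ℝ (Fin 4))), ℂ)) : Set 𝓢((Fin n → (EuclideanSpace ℝ (Fin 4))), ℂ)))
    {s : ℕ} {α β : ℝ}
    (hbound : ∀ (n : ℕ) (σ : Fin n → QCDField Nf), ∀ᶠ k in atTop, ∀ F : 𝓢((Fin n → (EuclideanSpace ℝ (Fin 4))), ℂ), IsOffDiagonal F →
      ‖qcdLatticeDist sch k n σ F‖ ≤ α * (n.factorial : ℝ) ^ β * schwartzNorm (n * s) F)
    (hconv : ∀ n : ℕ, n ≠ 0 → ∀ (σ : Fin n → QCDField Nf) (f : Fin n → 𝓢((EuclideanSpace ℝ (Fin 4)), ℝ)) (F : 𝓢((Fin n → (EuclideanSpace ℝ (Fin 4))), ℂ)),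
      IsTensorOf F (fun i => ofRealTest (f i)) → IsOffDiagonal F →
      ∃ c : ℂ, Tendsto (fun k => qcdLatticeSchwinger sch k n σ f) atTop (𝓝 c)) :
    ∀ (n : ℕ) (σ : Fin n → QCDField Nf) (F : 𝓢((Fin n → (EuclideanSpace ℝ (Fin 4))), ℂ)), IsOffDiagonal F →
      ∃ c : ℂ, Tendsto (fun k => qcdLatticeDist sch k n σ F) atTop (𝓝 c) := by
  intro n σ F hF
  rcases Nat.eq_zero_or_pos n with rfl | hn
  · exact ⟨F default, by simpa only [qcdLatticeDist_zero_apply] using tendsto_const_nhds⟩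
  · refine tendsto_offDiagonal_of_tensor (fun k => qcdLatticeDist sch k n σ) (hbound n σ) (hdense n) ?_ F hF
    rintro G ⟨f, hGf⟩ hGo
    obtain ⟨c, hc⟩ := hconv n hn.ne' σ f G hGf hGo
    exact ⟨c, hc.congr' (Eventually.of_forall fun k =>
      (qcdLatticeSchwinger_eq_qcdLatticeDist sch k n hn.ne' σ f G hGf).symm)⟩

/-! ### `QCDOf N_f` from the r3d package -/

/-- **`QCDOf N_f` from the lattice package read on real tensors and the rotation module.**  The r3d hypotheses are expanded
to those of `qcdOf_of_canonicalPackage`: convergence on `⁰𝒮` by `tendsto_qcdLatticeDist_of_tensor` (P2 + P3′ + the landed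
totality theorem `stub_offDiagonalTensorDensity`), asymptotic permutation symmetry identically by the landed exact symmetry
`stub_permExact`. [cite: OsterwalderSchraderCMP1975, §2, §4] -/
theorem qcdOf_of_latticePackage :
    ∀ {Nf : ℕ},
    (∃ reg : QCDRegularisation Nf, reg.HasMassScaling ∧ reg.IsChiralAtZero ∧
      ∀ m : Fin Nf → ℝ, (∀ f, 0 < m f) → ∃ (z shift : QCDField Nf → ℕ → ℝ),
        (reg.scheme m z shift).HasAsymptoticScaling ∧
        (∀ fl : Fin Nf, ∀ᶠ k in atTop, -1 < (reg.scheme m z shift).mq fl k) ∧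
        (∃ (s : ℕ) (α β : ℝ), 0 ≤ α ∧ ∀ (n : ℕ) (σ : Fin n → QCDField Nf), ∀ᶠ k in atTop,
          ∀ F : 𝓢((Fin n → (EuclideanSpace ℝ (Fin 4))), ℂ), IsOffDiagonal F →
            ‖qcdLatticeDist (reg.scheme m z shift) k n σ F‖ ≤ α * (n.factorial : ℝ) ^ β * schwartzNorm (n * s) F) ∧
        (∀ n : ℕ, n ≠ 0 → ∀ (σ : Fin n → QCDField Nf) (f : Fin n → 𝓢((EuclideanSpace ℝ (Fin 4)), ℝ)) (F : 𝓢((Fin n → (EuclideanSpace ℝ (Fin 4))), ℂ)),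
          IsTensorOf F (fun i => ofRealTest (f i)) → IsOffDiagonal F →
          ∃ c : ℂ, Tendsto (fun k => qcdLatticeSchwinger (reg.scheme m z shift) k n σ f) atTop (𝓝 c)) ∧
        (∀ (n : ℕ) (σ : Fin n → QCDField Nf) (a : (EuclideanSpace ℝ (Fin 4))) (F : 𝓢((Fin n → (EuclideanSpace ℝ (Fin 4))), ℂ)), IsOffDiagonal F →
          Tendsto (fun k => qcdLatticeDist (reg.scheme m z shift) k n σ (translateMulti a F) -
            qcdLatticeDist (reg.scheme m z shift) k n σ F) atTop (𝓝 0)) ∧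
        (∀ (N : ℕ) (deg : Fin N → ℕ) (lab : (j : Fin N) → Fin (deg j) → QCDField Nf)
          (F : (j : Fin N) → 𝓢((Fin (deg j) → (EuclideanSpace ℝ (Fin 4))), ℂ)), (∀ j, IsTimeOrdered (F j)) →
          ∀ H : (i j : Fin N) → 𝓢((Fin (deg i + deg j) → (EuclideanSpace ℝ (Fin 4))), ℂ),
            (∀ i j, IsAppendTensorOf (H i j) (osAdjoint (F i)) (F j)) →
            ∀ ε : ℝ, 0 < ε → ∀ᶠ l in atTop,
              -ε ≤ (∑ i, ∑ j, qcdLatticeDist (reg.scheme m z shift) l (deg i + deg j)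
                (Fin.append (lab i ∘ Fin.rev) (lab j)) (H i j)).re ∧
              |(∑ i, ∑ j, qcdLatticeDist (reg.scheme m z shift) l (deg i + deg j)
                (Fin.append (lab i ∘ Fin.rev) (lab j)) (H i j)).im| ≤ ε) ∧
        (∀ (n n' : ℕ) (σ : Fin n → QCDField Nf) (σ' : Fin n' → QCDField Nf) (F : 𝓢((Fin n → (EuclideanSpace ℝ (Fin 4))), ℂ))
          (G : 𝓢((Fin n' → (EuclideanSpace ℝ (Fin 4))), ℂ)), IsTimeOrdered F → IsTimeOrdered G → ∀ a : (EuclideanSpace ℝ (Fin 4)), a 0 = 0 → a ≠ 0 →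
          ∀ ε : ℝ, 0 < ε → ∃ t₀ : ℝ, ∀ t : ℝ, t₀ ≤ t → ∀ H : 𝓢((Fin (n + n') → (EuclideanSpace ℝ (Fin 4))), ℂ),
            IsAppendTensorOf H (osAdjoint F) (translateMulti (t • a) G) →
            ∀ᶠ k in atTop, ‖qcdLatticeDist (reg.scheme m z shift) k (n + n') (Fin.append (σ ∘ Fin.rev) σ') H -
              qcdLatticeDist (reg.scheme m z shift) k n (σ ∘ Fin.rev) (osAdjoint F) *
                qcdLatticeDist (reg.scheme m z shift) k n' σ' G‖ ≤ ε) ∧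
        (∃ Δ : ℝ, 0 < Δ ∧ (reg.scheme m z shift).HasSpeciesCSClustering Δ ∧
          (reg.scheme m z shift).HasLatticeMassGap Δ) ∧
        (∃ (F G : 𝓢((Fin 1 → (EuclideanSpace ℝ (Fin 4))), ℂ)) (H : 𝓢((Fin (1 + 1) → (EuclideanSpace ℝ (Fin 4))), ℂ)),
          IsTimeOrdered F ∧ IsTimeOrdered G ∧ IsAppendTensorOf H (osAdjoint F) G ∧ ∃ ε : ℝ, 0 < ε ∧
            ∀ᶠ k in atTop, ε ≤ ‖qcdLatticeDist (reg.scheme m z shift) k (1 + 1) (fun _ => QCDField.glue) H -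
              qcdLatticeDist (reg.scheme m z shift) k 1 (fun _ => QCDField.glue) (osAdjoint F) *
                qcdLatticeDist (reg.scheme m z shift) k 1 (fun _ => QCDField.glue) G‖) ∧
        (∀ f g : Fin Nf, f ≠ g → ∃ (F G : 𝓢((Fin 1 → (EuclideanSpace ℝ (Fin 4))), ℂ)) (H : 𝓢((Fin (1 + 1) → (EuclideanSpace ℝ (Fin 4))), ℂ)),
          IsTimeOrdered F ∧ IsTimeOrdered G ∧ IsAppendTensorOf H (osAdjoint F) G ∧ ∃ ε : ℝ, 0 < ε ∧
            ∀ᶠ k in atTop, ε ≤ ‖qcdLatticeDist (reg.scheme m z shift) k (1 + 1) (fun _ => QCDField.pseudoRe f g) H -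
              qcdLatticeDist (reg.scheme m z shift) k 1 (fun _ => QCDField.pseudoRe f g) (osAdjoint F) *
                qcdLatticeDist (reg.scheme m z shift) k 1 (fun _ => QCDField.pseudoRe f g) G‖) ∧
        (∃ (f g h : 𝓢((EuclideanSpace ℝ (Fin 4)), ℂ)) (Ffgh : 𝓢((Fin 3 → (EuclideanSpace ℝ (Fin 4))), ℂ)) (Fgh Ffh Ffg : 𝓢((Fin 2 → (EuclideanSpace ℝ (Fin 4))), ℂ))
          (Ff Fg Fh : 𝓢((Fin 1 → (EuclideanSpace ℝ (Fin 4))), ℂ)),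
          IsTensorOf Ffgh ![f, g, h] ∧ IsOffDiagonal Ffgh ∧ IsTensorOf Fgh ![g, h] ∧ IsTensorOf Ffh ![f, h] ∧
          IsTensorOf Ffg ![f, g] ∧ IsOffDiagonal Fgh ∧ IsOffDiagonal Ffh ∧ IsOffDiagonal Ffg ∧
          IsTensorOf Ff ![f] ∧ IsTensorOf Fg ![g] ∧ IsTensorOf Fh ![h] ∧ ∃ ε : ℝ, 0 < ε ∧
            ∀ᶠ k in atTop, ε ≤ ‖qcdLatticeDist (reg.scheme m z shift) k 3 (fun _ => QCDField.glue) Ffgh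
              - qcdLatticeDist (reg.scheme m z shift) k 1 (fun _ => QCDField.glue) Ff *
                  qcdLatticeDist (reg.scheme m z shift) k 2 (fun _ => QCDField.glue) Fgh
              - qcdLatticeDist (reg.scheme m z shift) k 1 (fun _ => QCDField.glue) Fg *
                  qcdLatticeDist (reg.scheme m z shift) k 2 (fun _ => QCDField.glue) Ffh
              - qcdLatticeDist (reg.scheme m z shift) k 1 (fun _ => QCDField.glue) Fh *
                  qcdLatticeDist (reg.scheme m z shift) k 2 (fun _ => QCDField.glue) Ffg
              + 2 * (qcdLatticeDist (reg.scheme m z shift) k 1 (fun _ => QCDField.glue) Ff *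
                  qcdLatticeDist (reg.scheme m z shift) k 1 (fun _ => QCDField.glue) Fg *
                  qcdLatticeDist (reg.scheme m z shift) k 1 (fun _ => QCDField.glue) Fh)‖)) →
    (∀ sch : QCDScheme Nf, sch.HasAsymptoticScaling →
      (∀ fl : Fin Nf, ∀ᶠ k in atTop, -1 < sch.mq fl k) → (∃ Δ : ℝ, 0 < Δ ∧ sch.HasLatticeMassGap Δ) →
      ∀ S : LabelledSchwingerFamily (QCDField Nf) (EuclideanSpace ℝ (Fin 4)),
        (∀ n : ℕ, n ≠ 0 → ∀ (σ : Fin n → QCDField Nf) (f : Fin n → 𝓢((EuclideanSpace ℝ (Fin 4)), ℝ)) (F : 𝓢((Fin n → (EuclideanSpace ℝ (Fin 4))), ℂ)),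
          IsTensorOf F (fun i => ofRealTest (f i)) → IsOffDiagonal F →
          Tendsto (fun k => qcdLatticeSchwinger sch k n σ f) atTop (𝓝 (S n σ F))) →
        ∀ (n : ℕ) (σ : Fin n → QCDField Nf) (R : (EuclideanSpace ℝ (Fin 4)) ≃ₗᵢ[ℝ] (EuclideanSpace ℝ (Fin 4))),
          LinearMap.det (R.toLinearEquiv : (EuclideanSpace ℝ (Fin 4)) →ₗ[ℝ] (EuclideanSpace ℝ (Fin 4))) = 1 →
          ∀ F : 𝓢((Fin n → (EuclideanSpace ℝ (Fin 4))), ℂ), IsOffDiagonal F → S n σ (linActMulti R F) = S n σ F) →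
    QCDOf Nf := by
  intro Nf hpkg hrot
  obtain ⟨reg, hms, hχ, hall⟩ := hpkg
  refine qcdOf_of_canonicalPackage ⟨reg, hms, hχ, fun m hm => ?_⟩ hrot
  obtain ⟨z, shift, hAS, hbr, ⟨s, α, β, hα, hb⟩, hconv, htrans, hrp, hcl, hgap, hglue, hpseudo, hκ₃⟩ := hall m hm
  refine ⟨z, shift, hAS, hbr, ⟨s, α, β, hα, hb⟩, ?_, htrans, ?_, hrp, hcl, hgap, hglue, hpseudo, hκ₃⟩
  · exact tendsto_qcdLatticeDist_of_tensor (reg.scheme m z shift) stub_offDiagonalTensorDensity hb hconv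
  · intro n σ π F _
    have h0 : (fun k => qcdLatticeDist (reg.scheme m z shift) k n σ (permTest π F) -
        qcdLatticeDist (reg.scheme m z shift) k n (σ ∘ π) F) = fun _ => 0 :=
      funext fun k => by rw [stub_permExact, sub_self]
    rw [h0]
    exact tendsto_const_nhds

end Summit.QuantumFields.QCD.Cruxes.StableActionBridge.Sketch

end
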